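import Summits.QuantumFields.BalabanUV.Beta.FP.GhostGramJets

/-!
# `BalabanUV.Beta.FP.GhostGramJetsSecond` — road «FP» (binder row D1), organisation γ, row GAMMA-9 (a) MODEL, FILE 3:
# **THE SECOND JET OF THE MINIMISER IN THE LETTERS `Γ, 𝓘, 𝔊`** — the `I₂` input of `GhostGramJets.hasDerivAt_gramFirstVar` made explicit, so the Gram loop
# catalogue of the K_n-ghost's polarization is a word in {`Γ, 𝓘, 𝔊, (𝓘ᵀ𝓘)⁻¹`} × {`Ḣ, Ḧ, Q̇, Q̈`} with no abstract jet left

HONEST DEPENDENCY (page 1, mandatory): continuum YM on T⁴ ⇐ BetaPertH ∧ nine spine estimates (0/9 proved); BetaPertH ⇐ (D1) ∧ (D4) ∧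
CAP+tail; G-an2-4 gates asym, D1 and NE2/3/4.  HONEST FRAMING (cell contract, verbatim): «discharging `BetaPertH` makes Bałaban's UV
stability UNCONDITIONAL — a real constructive-QFT result; it is NOT the continuum limit and NOT the Clay problem.»  THIS MODULE DISCHARGES
NOTHING of the wall: [folklore] one-variable product-rule calculus over `D1BFx.SliceTransferModel` (`hasDerivAt_matMul`, `hasDerivAt_transpose`) and
FILE 2 `FP.GhostGramJets` (`hasDerivAt_flucCov`, `hasDerivAt_minOp`, `hasDerivAt_effForm`) BY NAME.  No `def`, no `def … : Prop`, nothing cited, 0 sorry;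
0∕4 binders of row D1; NOT hbook, NOT D1, NOT BetaPertH, NOT continuum, NOT Clay.

ABSOLUTE RULE (cell charter, verbatim): «No internally-minted statement may enter as a cited fact. Every hypothesis is either kernel-proved
in this package or a verbatim quotation of a PUBLISHED theorem with page reference. The manuscript(s) under audit are NOT citable for their
own disputed steps — they are the thing under adjudication; programme-internal (2001/route/tribunal) claims are never citable.»

CONTENT.  With `Γ, 𝓘, 𝔊` the three blocks of `(kkt (H t) (Q t))⁻¹`, `Ḣ = H₁ t`, `Q̇ = Q₁ t`, `Ḧ = H₂`, `Q̈ = Q₂` and the FIRST JETS of FILE 2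
`Γ̇ = −(ΓḢΓ + 𝓘Q̇Γ + ΓQ̇ᵀ𝓘ᵀ)`, `İ = −(ΓḢ𝓘 + 𝓘Q̇𝓘 − ΓQ̇ᵀ𝔊)`, `𝔊̇ = 𝓘ᵀḢ𝓘 − 𝔊Q̇𝓘 − 𝓘ᵀQ̇ᵀ𝔊`:
* `hasDerivAt_minOp_jet₁` — the minimiser's first-jet CURVE `u ↦ −(Γ_uḢ_u𝓘_u + 𝓘_uQ̇_u𝓘_u − Γ_uQ̇_uᵀ𝔊_u)` has derivative at `t`
  **`Ï = −(Γ̇Ḣ𝓘 + ΓḦ𝓘 + ΓḢİ) − (İQ̇𝓘 + 𝓘Q̈𝓘 + 𝓘Q̇İ) + (Γ̇Q̇ᵀ𝔊 + ΓQ̈ᵀ𝔊 + ΓQ̇ᵀ𝔊̇)`** (symmetric `H t`, `det kkt(H t)(Q t) ≠ 0`) — the `hI₁` input of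
  `GhostGramJets.hasDerivAt_gramFirstVar` ∕ `hasDerivAt_ghostFirstVar` with `I₂ := Ï`; hence the Gram loops `½·secondVar(𝓘ᵀ𝓘; İᵀ𝓘 + 𝓘ᵀİ, Ïᵀ𝓘 + 2İᵀİ + 𝓘ᵀÏ)`
  are explicit words: legs in {`Γ, 𝓘, 𝔊, (𝓘ᵀ𝓘)⁻¹`}, vertices in {`Ḣ, Ḧ, Q̇, Q̈`}.
NOT HERE: letters, counting, `U_n`.
Unit `b2b-balaban-beta-d1-formalise-leaf-05` (gen 12), 2026-08-21; `LEAVES-FP.md` row GAMMA-9 (a).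
-/

noncomputable section

namespace Summit.QuantumFields.BalabanUV.Beta.FP.GhostGramJetsSecond

open Matrix Filter
open scoped Matrix BigOperators Topology
open Literature.MathematicalPhysics.QuantumFieldTheory.Balaban1983to89.Beta.Composition (kkt)
open Literature.MathematicalPhysics.QuantumFieldTheory.Balaban1983to89.Beta.CompositionSingular (flucCov minOp effForm)
open Summit.QuantumFields.BalabanUV.Beta.D1BFx.SliceTransferModel (hasDerivAt_matMul hasDerivAt_transpose)
open Summit.QuantumFields.BalabanUV.Beta.FP.GhostGramJets (hasDerivAt_flucCov hasDerivAt_minOp hasDerivAt_effForm)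

variable {ν μ : Type*} [Fintype ν] [Fintype μ] [DecidableEq ν] [DecidableEq μ]

/-- [folklore] Product rule for a TRIPLE matrix product, in the grouped form `(XYZ)′ = X′YZ + XY′Z + XYZ′`. -/
theorem hasDerivAt_matMul₃ {ι κ θ ρ : Type*} [Fintype ι] [Fintype κ] [Fintype θ] [Fintype ρ]
    {X : ℝ → ι → κ → ℝ} {Y : ℝ → κ → θ → ℝ} {Z : ℝ → θ → ρ → ℝ} {X' : Matrix ι κ ℝ} {Y' : Matrix κ θ ℝ} {Z' : Matrix θ ρ ℝ} {t : ℝ}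
    (hX : HasDerivAt X (Matrix.of.symm X') t) (hY : HasDerivAt Y (Matrix.of.symm Y') t) (hZ : HasDerivAt Z (Matrix.of.symm Z') t) :
    HasDerivAt (fun u => Matrix.of.symm (Matrix.of (X u) * Matrix.of (Y u) * Matrix.of (Z u)))
      (Matrix.of.symm (X' * Matrix.of (Y t) * Matrix.of (Z t) + Matrix.of (X t) * Y' * Matrix.of (Z t)
        + Matrix.of (X t) * Matrix.of (Y t) * Z')) t := by
  have hXY := hasDerivAt_matMul hX hY
  have h := hasDerivAt_matMul (X := fun u => Matrix.of.symm (Matrix.of (X u) * Matrix.of (Y u))) hXY hZ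
  refine h.congr_deriv ?_
  simp only [Equiv.apply_symm_apply, Matrix.add_mul]

/-- [folklore] **THE SECOND JET OF THE MINIMISER.**  Along `C²` curves `H` (symmetric at `t`), `Q` with first-jet curves `H₁`, `Q₁` (derivatives of `H`, `Q`
at `t` are `H₁ t`, `Q₁ t`) and second jets `H₂`, `Q₂` at `t`, `det kkt(H t)(Q t) ≠ 0`: the minimiser's first-jet curve
`u ↦ −(Γ_u·H₁ u·𝓘_u + 𝓘_u·Q₁ u·𝓘_u − Γ_u·(Q₁ u)ᵀ·𝔊_u)` (FILE 2 `hasDerivAt_minOp_eventually`) has derivative at `t`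
`Ï = −(Γ̇Ḣ𝓘 + ΓḦ𝓘 + ΓḢİ) − (İQ̇𝓘 + 𝓘Q̈𝓘 + 𝓘Q̇İ) + (Γ̇Q̇ᵀ𝔊 + ΓQ̈ᵀ𝔊 + ΓQ̇ᵀ𝔊̇)` with the first jets `Γ̇, İ, 𝔊̇` of FILE 2 written out. -/
theorem hasDerivAt_minOp_jet₁ {H H₁ : ℝ → ν → ν → ℝ} {H₂ : Matrix ν ν ℝ} {Q Q₁ : ℝ → μ → ν → ℝ} {Q₂ : Matrix μ ν ℝ} {t : ℝ}
    (hH : HasDerivAt H (H₁ t) t) (hH₁ : HasDerivAt H₁ (Matrix.of.symm H₂) t)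
    (hQ : HasDerivAt Q (Q₁ t) t) (hQ₁ : HasDerivAt Q₁ (Matrix.of.symm Q₂) t)
    (hsym : (Matrix.of (H t))ᵀ = Matrix.of (H t)) (hdet : (kkt (Matrix.of (H t)) (Matrix.of (Q t))).det ≠ 0) :
    HasDerivAt (fun u => Matrix.of.symm
        (-(flucCov (Matrix.of (H u)) (Matrix.of (Q u)) * Matrix.of (H₁ u) * minOp (Matrix.of (H u)) (Matrix.of (Q u))
          + minOp (Matrix.of (H u)) (Matrix.of (Q u)) * Matrix.of (Q₁ u) * minOp (Matrix.of (H u)) (Matrix.of (Q u))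
          - flucCov (Matrix.of (H u)) (Matrix.of (Q u)) * (Matrix.of (Q₁ u))ᵀ * effForm (Matrix.of (H u)) (Matrix.of (Q u)))))
      (Matrix.of.symm
        (-((-(flucCov (Matrix.of (H t)) (Matrix.of (Q t)) * Matrix.of (H₁ t) * flucCov (Matrix.of (H t)) (Matrix.of (Q t))
                + minOp (Matrix.of (H t)) (Matrix.of (Q t)) * Matrix.of (Q₁ t) * flucCov (Matrix.of (H t)) (Matrix.of (Q t))
                + flucCov (Matrix.of (H t)) (Matrix.of (Q t)) * (Matrix.of (Q₁ t))ᵀ * (minOp (Matrix.of (H t)) (Matrix.of (Q t)))ᵀ))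
              * Matrix.of (H₁ t) * minOp (Matrix.of (H t)) (Matrix.of (Q t))
            + flucCov (Matrix.of (H t)) (Matrix.of (Q t)) * H₂ * minOp (Matrix.of (H t)) (Matrix.of (Q t))
            + flucCov (Matrix.of (H t)) (Matrix.of (Q t)) * Matrix.of (H₁ t)
              * -(flucCov (Matrix.of (H t)) (Matrix.of (Q t)) * Matrix.of (H₁ t) * minOp (Matrix.of (H t)) (Matrix.of (Q t))
                  + minOp (Matrix.of (H t)) (Matrix.of (Q t)) * Matrix.of (Q₁ t) * minOp (Matrix.of (H t)) (Matrix.of (Q t))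
                  - flucCov (Matrix.of (H t)) (Matrix.of (Q t)) * (Matrix.of (Q₁ t))ᵀ * effForm (Matrix.of (H t)) (Matrix.of (Q t))))
          - (-(flucCov (Matrix.of (H t)) (Matrix.of (Q t)) * Matrix.of (H₁ t) * minOp (Matrix.of (H t)) (Matrix.of (Q t))
                + minOp (Matrix.of (H t)) (Matrix.of (Q t)) * Matrix.of (Q₁ t) * minOp (Matrix.of (H t)) (Matrix.of (Q t))
                - flucCov (Matrix.of (H t)) (Matrix.of (Q t)) * (Matrix.of (Q₁ t))ᵀ * effForm (Matrix.of (H t)) (Matrix.of (Q t)))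
              * Matrix.of (Q₁ t) * minOp (Matrix.of (H t)) (Matrix.of (Q t))
            + minOp (Matrix.of (H t)) (Matrix.of (Q t)) * Q₂ * minOp (Matrix.of (H t)) (Matrix.of (Q t))
            + minOp (Matrix.of (H t)) (Matrix.of (Q t)) * Matrix.of (Q₁ t)
              * -(flucCov (Matrix.of (H t)) (Matrix.of (Q t)) * Matrix.of (H₁ t) * minOp (Matrix.of (H t)) (Matrix.of (Q t))
                  + minOp (Matrix.of (H t)) (Matrix.of (Q t)) * Matrix.of (Q₁ t) * minOp (Matrix.of (H t)) (Matrix.of (Q t))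
                  - flucCov (Matrix.of (H t)) (Matrix.of (Q t)) * (Matrix.of (Q₁ t))ᵀ * effForm (Matrix.of (H t)) (Matrix.of (Q t))))
          + (-(flucCov (Matrix.of (H t)) (Matrix.of (Q t)) * Matrix.of (H₁ t) * flucCov (Matrix.of (H t)) (Matrix.of (Q t))
                + minOp (Matrix.of (H t)) (Matrix.of (Q t)) * Matrix.of (Q₁ t) * flucCov (Matrix.of (H t)) (Matrix.of (Q t))
                + flucCov (Matrix.of (H t)) (Matrix.of (Q t)) * (Matrix.of (Q₁ t))ᵀ * (minOp (Matrix.of (H t)) (Matrix.of (Q t)))ᵀ)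
              * (Matrix.of (Q₁ t))ᵀ * effForm (Matrix.of (H t)) (Matrix.of (Q t))
            + flucCov (Matrix.of (H t)) (Matrix.of (Q t)) * Q₂ᵀ * effForm (Matrix.of (H t)) (Matrix.of (Q t))
            + flucCov (Matrix.of (H t)) (Matrix.of (Q t)) * (Matrix.of (Q₁ t))ᵀ
              * ((minOp (Matrix.of (H t)) (Matrix.of (Q t)))ᵀ * Matrix.of (H₁ t) * minOp (Matrix.of (H t)) (Matrix.of (Q t))
                - effForm (Matrix.of (H t)) (Matrix.of (Q t)) * Matrix.of (Q₁ t) * minOp (Matrix.of (H t)) (Matrix.of (Q t))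
                - (minOp (Matrix.of (H t)) (Matrix.of (Q t)))ᵀ * (Matrix.of (Q₁ t))ᵀ * effForm (Matrix.of (H t)) (Matrix.of (Q t)))))) t := by
  -- the basic curves read as matrices, and the three block jets of FILE 2 at `t`
  have hH' : HasDerivAt H (Matrix.of.symm (Matrix.of (H₁ t))) t := hH
  have hQ' : HasDerivAt Q (Matrix.of.symm (Matrix.of (Q₁ t))) t := hQ
  have hΓ := hasDerivAt_flucCov hH' hQ' hsym hdet
  have hI := hasDerivAt_minOp hH' hQ' hsym hdet
  have hG := hasDerivAt_effForm hH' hQ' hsym hdet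
  have hQ₁T := hasDerivAt_transpose hQ₁
  -- the three triple products
  have h1 := hasDerivAt_matMul₃ (X := fun u => Matrix.of.symm (flucCov (Matrix.of (H u)) (Matrix.of (Q u)))) (Y := H₁)
    (Z := fun u => Matrix.of.symm (minOp (Matrix.of (H u)) (Matrix.of (Q u)))) hΓ hH₁ hI
  have h2 := hasDerivAt_matMul₃ (X := fun u => Matrix.of.symm (minOp (Matrix.of (H u)) (Matrix.of (Q u)))) (Y := Q₁)
    (Z := fun u => Matrix.of.symm (minOp (Matrix.of (H u)) (Matrix.of (Q u)))) hI hQ₁ hI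
  have h3 := hasDerivAt_matMul₃ (X := fun u => Matrix.of.symm (flucCov (Matrix.of (H u)) (Matrix.of (Q u))))
    (Y := fun u => Matrix.of.symm (Matrix.of (Q₁ u))ᵀ)
    (Z := fun u => Matrix.of.symm (effForm (Matrix.of (H u)) (Matrix.of (Q u)))) hΓ hQ₁T hG
  have h := ((h1.add h2).sub h3).neg
  refine (h.congr_of_eventuallyEq (Eventually.of_forall fun u => ?_)).congr_deriv ?_
  · simp only [Equiv.apply_symm_apply, Pi.neg_apply, Pi.add_apply, Pi.sub_apply]
    rfl
  · simp only [Equiv.apply_symm_apply]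
    funext i j
    simp only [Matrix.of_symm_apply, Pi.neg_apply, Pi.add_apply, Pi.sub_apply, Matrix.neg_apply, Matrix.add_apply, Matrix.sub_apply]
    ring

end Summit.QuantumFields.BalabanUV.Beta.FP.GhostGramJetsSecond

end
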